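import Summits.NavierStokesRegularity.FluidComputer.LipRowClock
import Summits.NavierStokesRegularity.FluidComputer.SobolevLadderSerrin
import HarnessLib

/-!
# Fluid computer — L61 in its other forms: `u ∉ L¹_t Ḃ^{5/2}_{2,1}` with a logarithmic floor, and the
# ENERGY-HEADED inviscid countdown per level from the sharp clock

HONEST FRAMING (cell `pub-fluidc`, verbatim): *low prior, high value-of-information experiment on Tao's
machine paradigm; NOT a claim that NS blows up.* Theorem side of the cell (the level dictionary); nothing here is
evidence of blow-up. Companion of `LipRowClock` (L61: `c (T − t)^{−1} ≤ P(t) = ∑_l 2^{5l/2}‖Δ̇_l u(t)‖₂`, `c` ABSOLUTE), along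
every maximal smooth Leray–Hopf solution of the unforced Navier–Stokes system on `ℝ³` (`ν > 0`):

* `lipRow_log_floor`, `lipRow_lintegral_eq_top` (**L61-S**) — `c log((T − t₀)/(T − t)) ≤ ∫_{t₀}^t P` and
  `∫_{(t₀,T)} P = ∞`: `u ∉ L¹_t(Ḃ^{5/2}_{2,1})_x` on every terminal window — the Beale–Kato–Majda statement
  (`∫‖∇u‖_∞ = ∞`, here `P ≳ ‖∇u‖_∞`) WITH a logarithmic rate and an absolute constant;
* `lipRow_front_clock`, `lipRow_countdown`, `lipRow_tail_tendsto_top` (**L61″**) — the levels below `J` carry at most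
  `C₂ ‖u(0)‖₂ 2^{5(J−1)/2} G` of `P` (`SobolevLadderFront.tsum_ladder_low_le`), so while the row above `J` is within that
  allowance, `c ≤ 2 C₂ G ‖u(0)‖₂ 2^{5(J−1)/2} (T − t)`: **`T − t ≥ c · 2^{−5(J−1)/2}/(2C₂G‖u(0)‖₂)`** — the inviscid countdown
  per level of L59″, now from the SHARP clock (absolute `c`; the energy enters only through the head); tails → `∞`.

0 sorry; no definitions; no named facts.

## References

* D. S. McCormick et al., SIAM J. Math. Anal. 48 (2016) 2119–2132, Thm. 1.1. [MccormickEtAl2016]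
* J. T. Beale, T. Kato, A. Majda, Comm. Math. Phys. 94 (1984) 61–66, Thm. 1. [BealeKatoMajda1984]
-/

noncomputable section

open MeasureTheory Set Function Filter Topology
open scoped ENNReal NNReal
open Literature.Analysis.FluidPDE Literature.Analysis.FunctionSpaces
open Summit.NavierStokesRegularity.FluidComputer.LipRowClock
open Summit.NavierStokesRegularity.FluidComputer.SobolevLadderSerrin
open Summit.NavierStokesRegularity.FluidComputer.SobolevLadderFront (tsum_ladder_low_le tsum_geom_lt_top tendsto_ofReal_clock_top)
open Summit.NavierStokesRegularity.FluidComputer.CriticalLevels (tsum_int_eq_low_add_tail)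

namespace Summit.NavierStokesRegularity.FluidComputer.LipRowForms

/-! ## L61-S: time-integrated -/

/-- **L61-S — LOGARITHMIC FLOOR OF THE RUNNING `L¹_t Ḃ^{5/2}_{2,1}` INTEGRAL.** With the absolute constant `c` of
`lipRow_clock`: along every maximal smooth Leray–Hopf solution of the unforced system (`ν > 0`), for all `0 ≤ t₀ ≤ t < T`:
`c · log((T − t₀)/(T − t)) ≤ ∫⁻_{(t₀,t)} ∑_l 2^{5l/2} ‖Δ̇_l u(τ)‖₂ dτ`. [cite: MccormickEtAl2016, Thm. 1.1]
[cite: BealeKatoMajda1984, Thm. 1] -/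
theorem lipRow_log_floor :
    ∃ c : ℝ, 0 < c ∧ ∀ (ν T : ℝ), 0 < ν → 0 < T →
      ∀ (u : ℝ → EuclideanSpace ℝ (Fin 3) → EuclideanSpace ℝ (Fin 3)) (p : ℝ → EuclideanSpace ℝ (Fin 3) → ℝ),
      IsMaximalSmoothSolution ν 0 u p T → IsLerayHopfOn T ν 0 (u 0) u →
      ∀ t₀ t : ℝ, 0 ≤ t₀ → t₀ ≤ t → t < T →
        ENNReal.ofReal (c * Real.log ((T - t₀) / (T - t))) ≤
          ∫⁻ τ in Ioo t₀ t, ∑' l : ℤ, (2 : ℝ≥0∞) ^ ((5 / 2 : ℝ) * (l : ℝ)) * blockL2 (u τ) l := by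
  obtain ⟨c, hc, H⟩ := lipRow_clock
  refine ⟨c, hc, fun ν T hν hT u p hmax hLH t₀ t ht₀ h₀ ht => ?_⟩
  have h := log_le_lintegral_rpow_of_clock (c := c) (ν := ν) (a := (0 : ℝ)) (b := (1 : ℝ)) (T := T) hc hν one_pos h₀ ht
    (X := fun τ => ∑' l : ℤ, (2 : ℝ≥0∞) ^ ((5 / 2 : ℝ) * (l : ℝ)) * blockL2 (u τ) l)
    (fun τ hτ => by
      have := H ν T hν hT u p hmax hLH τ ⟨ht₀.trans_lt hτ.1, hτ.2.trans ht⟩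
      simpa only [Real.rpow_zero, mul_one] using this)
  simpa only [div_one, Real.rpow_zero, mul_one, Real.rpow_one, ENNReal.rpow_one] using h

/-- **L61-S — `u ∉ L¹(t₀, T; Ḃ^{5/2}_{2,1})` ON EVERY TERMINAL WINDOW**: along every maximal smooth Leray–Hopf solution of
the unforced system (`ν > 0`), for every `t₀ ∈ [0, T)`: `∫⁻_{(t₀,T)} ∑_l 2^{5l/2} ‖Δ̇_l u(τ)‖₂ dτ = ∞` (compare
Beale–Kato–Majda, `∫‖∇u‖_∞ = ∞`; here with the logarithmic floor above). [cite: BealeKatoMajda1984, Thm. 1]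
[cite: MccormickEtAl2016, Thm. 1.1] -/
theorem lipRow_lintegral_eq_top {ν T : ℝ} (hν : 0 < ν) (hT : 0 < T)
    {u : ℝ → EuclideanSpace ℝ (Fin 3) → EuclideanSpace ℝ (Fin 3)} {p : ℝ → EuclideanSpace ℝ (Fin 3) → ℝ}
    (hmax : IsMaximalSmoothSolution ν 0 u p T) (hLH : IsLerayHopfOn T ν 0 (u 0) u)
    {t₀ : ℝ} (ht₀ : t₀ ∈ Ico 0 T) :
    ∫⁻ τ in Ioo t₀ T, ∑' l : ℤ, (2 : ℝ≥0∞) ^ ((5 / 2 : ℝ) * (l : ℝ)) * blockL2 (u τ) l = ∞ := by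
  obtain ⟨c, hc, H⟩ := lipRow_clock
  have h := lintegral_rpow_eq_top_of_clock (c := c) (ν := ν) (a := (0 : ℝ)) (b := (1 : ℝ)) hc hν one_pos ht₀.2
    (X := fun τ => ∑' l : ℤ, (2 : ℝ≥0∞) ^ ((5 / 2 : ℝ) * (l : ℝ)) * blockL2 (u τ) l)
    (fun τ hτ => by
      have := H ν T hν hT u p hmax hLH τ ⟨ht₀.1.trans_lt hτ.1, hτ.2⟩
      simpa only [Real.rpow_zero, mul_one] using this)
  simpa only [div_one, ENNReal.rpow_one] using h

/-! ## L61″: the front clock and the countdown per level -/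

/-- **L61″ — THE `Ḃ^{5/2}_{2,1}` FRONT CLOCK.** With the absolute `c` of `lipRow_clock`, `C₂ = (lpBounds (Fin 3)).C₂`,
`G = ∑_n 2^{−5n/2}`: along every maximal smooth Leray–Hopf solution of the unforced system (`ν > 0`), at EVERY `t ∈ (0, T)`
and EVERY `J ∈ ℤ`: `c (T − t)^{−1} ≤ C₂ ‖u(0)‖₂ 2^{5(J−1)/2} G + ∑_{n≥0} 2^{5(J+n)/2} ‖Δ̇_{J+n} u(t)‖₂`.
[cite: MccormickEtAl2016, Thm. 1.1] [cite: BahouriCheminDanchin2011, Prop. 2.12] -/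
theorem lipRow_front_clock :
    ∃ c : ℝ, 0 < c ∧ ∀ (ν T : ℝ), 0 < ν → 0 < T →
      ∀ (u : ℝ → EuclideanSpace ℝ (Fin 3) → EuclideanSpace ℝ (Fin 3)) (p : ℝ → EuclideanSpace ℝ (Fin 3) → ℝ),
      IsMaximalSmoothSolution ν 0 u p T → IsLerayHopfOn T ν 0 (u 0) u →
      ∀ t ∈ Ioo 0 T, ∀ J : ℤ,
        ENNReal.ofReal (c * (T - t) ^ (-(1 : ℝ))) ≤
          ((lpBounds (Fin 3)).C₂ : ℝ≥0∞) * eLpNorm (u 0) 2 volume * (2 : ℝ≥0∞) ^ ((5 / 2 : ℝ) * ((J - 1 : ℤ) : ℝ)) *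
              (∑' n : ℕ, ((2 : ℝ≥0∞) ^ (-(5 / 2 : ℝ))) ^ n) +
            ∑' n : ℕ, (2 : ℝ≥0∞) ^ ((5 / 2 : ℝ) * ((J + n : ℤ) : ℝ)) * blockL2 (u t) (J + n) := by
  obtain ⟨c, hc, H⟩ := lipRow_clock
  refine ⟨c, hc, fun ν T hν hT u p hmax hLH t ht J => (H ν T hν hT u p hmax hLH t ht).trans ?_⟩
  have hut : MemLp (u t) 2 volume := hLH.memLp t ⟨ht.1.le, ht.2.le⟩
  rw [tsum_int_eq_low_add_tail (fun j => (2 : ℝ≥0∞) ^ ((5 / 2 : ℝ) * (j : ℝ)) * blockL2 (u t) j) J]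
  refine add_le_add ?_ le_rfl
  refine (tsum_ladder_low_le hut J).trans ?_
  gcongr
  exact hLH.eLpNorm_le_eLpNorm_datum hν.le (hLH.memLp 0 ⟨le_rfl, hT.le⟩) ⟨ht.1.le, ht.2.le⟩

/-- **L61″ — THE INVISCID COUNTDOWN PER LEVEL FROM THE SHARP CLOCK.** With `c`, `C₂`, `G` as in `lipRow_front_clock`:
along every maximal smooth Leray–Hopf solution of the unforced system (`ν > 0`), at every `t ∈ (0, T)` and for every
level `J`, IF `∑_{n≥0} 2^{5(J+n)/2} ‖Δ̇_{J+n} u(t)‖₂ ≤ C₂ ‖u(0)‖₂ 2^{5(J−1)/2} G` (the `Ḃ^{5/2}_{2,1}`-front has not passed `J`),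
THEN `c ≤ 2 (C₂ G ‖u(0)‖₂ 2^{5(J−1)/2}) (T − t)` (real numbers): every unpassed level certifies a remaining time
`≥ c 2^{−5(J−1)/2}/(2C₂G‖u(0)‖₂)` — NO viscosity, absolute `c`, the energy only through the head allowance.
[cite: MccormickEtAl2016, Thm. 1.1] [cite: BahouriCheminDanchin2011, Prop. 2.12] -/
theorem lipRow_countdown :
    ∃ c : ℝ, 0 < c ∧ ∀ (ν T : ℝ), 0 < ν → 0 < T →
      ∀ (u : ℝ → EuclideanSpace ℝ (Fin 3) → EuclideanSpace ℝ (Fin 3)) (p : ℝ → EuclideanSpace ℝ (Fin 3) → ℝ),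
      IsMaximalSmoothSolution ν 0 u p T → IsLerayHopfOn T ν 0 (u 0) u →
      ∀ t ∈ Ioo 0 T, ∀ J : ℤ,
        (∑' n : ℕ, (2 : ℝ≥0∞) ^ ((5 / 2 : ℝ) * ((J + n : ℤ) : ℝ)) * blockL2 (u t) (J + n)) ≤
          ((lpBounds (Fin 3)).C₂ : ℝ≥0∞) * eLpNorm (u 0) 2 volume * (2 : ℝ≥0∞) ^ ((5 / 2 : ℝ) * ((J - 1 : ℤ) : ℝ)) *
              (∑' n : ℕ, ((2 : ℝ≥0∞) ^ (-(5 / 2 : ℝ))) ^ n) →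
        c ≤ 2 * (((lpBounds (Fin 3)).C₂ : ℝ) * (∑' n : ℕ, ((2 : ℝ≥0∞) ^ (-(5 / 2 : ℝ))) ^ n).toReal *
            (eLpNorm (u 0) 2 volume).toReal * (2 : ℝ) ^ ((5 / 2 : ℝ) * ((J - 1 : ℤ) : ℝ))) * (T - t) := by
  obtain ⟨c, hc, H⟩ := lipRow_front_clock
  refine ⟨c, hc, fun ν T hν hT u p hmax hLH t ht J hfront => ?_⟩
  set K := lpBounds (Fin 3) with hK
  set E : ℝ≥0∞ := eLpNorm (u 0) 2 volume with hE
  set Pw : ℝ≥0∞ := (2 : ℝ≥0∞) ^ ((5 / 2 : ℝ) * ((J - 1 : ℤ) : ℝ)) with hPw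
  set G : ℝ≥0∞ := ∑' n : ℕ, ((2 : ℝ≥0∞) ^ (-(5 / 2 : ℝ))) ^ n with hG
  have hEtop : E ≠ ⊤ := (hLH.memLp 0 ⟨le_rfl, hT.le⟩).eLpNorm_ne_top
  have hPwtop : Pw ≠ ⊤ := RiccatiSlice.two_rpow_ne_top _
  have hGtop : G ≠ ⊤ := (tsum_geom_lt_top (by norm_num : (0 : ℝ) < 5 / 2)).ne
  have hTt : 0 < T - t := sub_pos.2 ht.2
  have h := H ν T hν hT u p hmax hLH t ht J
  have h2 : ENNReal.ofReal (c * (T - t) ^ (-(1 : ℝ))) ≤ 2 * ((K.C₂ : ℝ≥0∞) * E * Pw * G) :=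
    calc ENNReal.ofReal (c * (T - t) ^ (-(1 : ℝ)))
        ≤ (K.C₂ : ℝ≥0∞) * E * Pw * G + ∑' n : ℕ, (2 : ℝ≥0∞) ^ ((5 / 2 : ℝ) * ((J + n : ℤ) : ℝ)) * blockL2 (u t) (J + n) := h
      _ ≤ (K.C₂ : ℝ≥0∞) * E * Pw * G + (K.C₂ : ℝ≥0∞) * E * Pw * G := add_le_add le_rfl hfront
      _ = 2 * ((K.C₂ : ℝ≥0∞) * E * Pw * G) := by ring
  have hXtop : (K.C₂ : ℝ≥0∞) * E * Pw * G ≠ ⊤ :=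
    ENNReal.mul_ne_top (ENNReal.mul_ne_top (ENNReal.mul_ne_top ENNReal.coe_ne_top hEtop) hPwtop) hGtop
  have h3 := ENNReal.toReal_mono (ENNReal.mul_ne_top (by norm_num) hXtop) h2
  rw [ENNReal.toReal_ofReal (by positivity)] at h3
  simp only [ENNReal.toReal_mul, ENNReal.toReal_ofNat, ENNReal.coe_toReal] at h3
  have hPw' : Pw.toReal = (2 : ℝ) ^ ((5 / 2 : ℝ) * ((J - 1 : ℤ) : ℝ)) := by
    rw [hPw, ← ENNReal.toReal_rpow]; norm_num
  set Xr : ℝ := (K.C₂ : ℝ) * G.toReal * E.toReal * (2 : ℝ) ^ ((5 / 2 : ℝ) * ((J - 1 : ℤ) : ℝ)) with hXr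
  have hX' : (K.C₂ : ℝ) * E.toReal * Pw.toReal * G.toReal = Xr := by rw [hXr, hPw']; ring
  have h4 : c * (T - t) ^ (-(1 : ℝ)) ≤ 2 * Xr := by rw [← hX']; exact h3
  rw [Real.rpow_neg_one] at h4
  have h5 : c = c * (T - t)⁻¹ * (T - t) := by field_simp
  rw [h5]
  exact mul_le_mul_of_nonneg_right h4 hTt.le

/-- **L61″ — EVERY TAIL OF THE `Ḃ^{5/2}_{2,1}` ROW DIVERGES**: along every maximal smooth Leray–Hopf solution of the
unforced system (`ν > 0`), for every fixed level `J`: `∑_{n≥0} 2^{5(J+n)/2} ‖Δ̇_{J+n} u(t)‖₂ → ∞` as `t ↑ T` (the head below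
`J` is bounded by the energy uniformly in time; the row tends to `∞`, `lipRow_tendsto_top`). [cite: MccormickEtAl2016, Thm. 1.1] -/
theorem lipRow_tail_tendsto_top {ν T : ℝ} (hν : 0 < ν) (hT : 0 < T)
    {u : ℝ → EuclideanSpace ℝ (Fin 3) → EuclideanSpace ℝ (Fin 3)} {p : ℝ → EuclideanSpace ℝ (Fin 3) → ℝ}
    (hmax : IsMaximalSmoothSolution ν 0 u p T) (hLH : IsLerayHopfOn T ν 0 (u 0) u) (J : ℤ) :
    Tendsto (fun t => ∑' n : ℕ, (2 : ℝ≥0∞) ^ ((5 / 2 : ℝ) * ((J + n : ℤ) : ℝ)) * blockL2 (u t) (J + n))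
      (𝓝[<] T) (𝓝 ∞) := by
  set K := lpBounds (Fin 3) with hK
  have hu0 : MemLp (u 0) 2 volume := hLH.memLp 0 ⟨le_rfl, hT.le⟩
  set Hd : ℝ≥0∞ := (K.C₂ : ℝ≥0∞) * eLpNorm (u 0) 2 volume * (2 : ℝ≥0∞) ^ ((5 / 2 : ℝ) * ((J - 1 : ℤ) : ℝ)) *
    (∑' n : ℕ, ((2 : ℝ≥0∞) ^ (-(5 / 2 : ℝ))) ^ n) with hHd
  have hHdtop : Hd ≠ ∞ := ENNReal.mul_ne_top (ENNReal.mul_ne_top (ENNReal.mul_ne_top ENNReal.coe_ne_top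
    hu0.eLpNorm_ne_top) (RiccatiSlice.two_rpow_ne_top _)) (tsum_geom_lt_top (by norm_num : (0 : ℝ) < 5 / 2)).ne
  have hY := lipRow_tendsto_top hν hT hmax hLH
  have hle : ∀ᶠ t in 𝓝[<] T, ∑' j : ℤ, (2 : ℝ≥0∞) ^ ((5 / 2 : ℝ) * (j : ℝ)) * blockL2 (u t) j ≤
      Hd + ∑' n : ℕ, (2 : ℝ≥0∞) ^ ((5 / 2 : ℝ) * ((J + n : ℤ) : ℝ)) * blockL2 (u t) (J + n) := by
    filter_upwards [Ioo_mem_nhdsLT hT] with t ht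
    have hut : MemLp (u t) 2 volume := hLH.memLp t ⟨ht.1.le, ht.2.le⟩
    rw [tsum_int_eq_low_add_tail (fun j => (2 : ℝ≥0∞) ^ ((5 / 2 : ℝ) * (j : ℝ)) * blockL2 (u t) j) J]
    refine add_le_add ((tsum_ladder_low_le hut J).trans ?_) le_rfl
    exact mul_le_mul' (mul_le_mul' (mul_le_mul' le_rfl
      (hLH.eLpNorm_le_eLpNorm_datum hν.le hu0 ⟨ht.1.le, ht.2.le⟩)) le_rfl) le_rfl
  rw [ENNReal.tendsto_nhds_top_iff_nnreal] at hY ⊢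
  intro x
  have hx : ∀ᶠ t in 𝓝[<] T, ((x : ℝ≥0∞) + Hd) < ∑' j : ℤ, (2 : ℝ≥0∞) ^ ((5 / 2 : ℝ) * (j : ℝ)) * blockL2 (u t) j := by
    have h := hY ((x : ℝ≥0∞) + Hd).toNNReal
    rwa [ENNReal.coe_toNNReal (ENNReal.add_ne_top.2 ⟨ENNReal.coe_ne_top, hHdtop⟩)] at h
  filter_upwards [hx, hle] with t h1 h2
  have h3 : (x : ℝ≥0∞) + Hd < Hd + ∑' n : ℕ, (2 : ℝ≥0∞) ^ ((5 / 2 : ℝ) * ((J + n : ℤ) : ℝ)) *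
      blockL2 (u t) (J + n) := h1.trans_le h2
  rw [add_comm (x : ℝ≥0∞)] at h3
  exact (ENNReal.add_lt_add_iff_left hHdtop).1 h3

end Summit.NavierStokesRegularity.FluidComputer.LipRowForms

end
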